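import Mathlib
import Summits.MatrixMultiplication.MatrixMultiplication.Theses.MatrixPointInterpolation
import Summits.MatrixMultiplication.MatrixMultiplication.Theorems.LongMasquerade.Negative.WindowedKaplanskyTwo

/-!
# Crux-strategist sketch for `MatrixPointInterpolation.LongMasquerade` (stmt-MatrixMultiplication-18938)

Negation lens ("windowed PI-class descent"): typed first lemmas of the disproof programme described in
`STRATEGY-CENSUS.md` / `idea-windowed-descent.md`.  Nothing here is asserted as proved: every `theorem`
below is a STATEMENT that elaborates (proof `sorry`), offered to the Negative lane (item
stmt-MatrixMultiplication-18945 `WindowedKaplansky`) and as the obstruction record for this crux.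
-/

namespace Summit.MatrixMultiplication.MatrixMultiplication.Cruxes.LongMasquerade.WindowedDescent

open scoped BigOperators
open Matrix

/-- `Win k D A`: every two-letter identity of `M_k(ℂ)` of degree `≤ D` vanishes at the pair `A`
(the route's window is `Win k (2*d) A`). -/
def Win (k D : ℕ) {n : ℕ} (A : Fin 2 → Matrix (Fin n) (Fin n) ℂ) : Prop :=
  ∀ (T : Finset (List (Fin 2))) (c : List (Fin 2) → ℂ), (∀ w ∈ T, w.length ≤ D) →
    (∀ B : Fin 2 → Matrix (Fin k) (Fin k) ℂ, (∑ w ∈ T, c w • (w.map B).prod) = 0) →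
    (∑ w ∈ T, c w • (w.map A).prod) = 0

/-- `Gen d A`: words of length `≤ d` in the pair `A` span `M_n`. -/
def Gen (d : ℕ) {n : ℕ} (A : Fin 2 → Matrix (Fin n) (Fin n) ℂ) : Prop :=
  Submodule.span ℂ {M : Matrix (Fin n) (Fin n) ℂ | ∃ w : List (Fin 2), w.length ≤ d ∧ (w.map A).prod = M} = ⊤

/-- The windowed descent step at point size `k`: for every target excess `E'` there are an input excess
`E` and a size threshold `N` such that a pair generating `M_n` (`n ≥ N`) in degree `d ≥ E` and carrying the
identities of `M_k` up to degree `d + E` (one full slot plus `E` letters of decoration) carries the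
identities of `M_{k-1}` up to degree `d + E'`. -/
def DescentStep (k : ℕ) : Prop :=
  ∀ E' : ℕ, ∃ E N : ℕ, ∀ (n d : ℕ) (A : Fin 2 → Matrix (Fin n) (Fin n) ℂ),
    N ≤ n → E ≤ d → Gen d A → Win k (d + E) A → Win (k - 1) (d + E') A

/-- RANK AMPLIFICATION (the engine of every level-one use of the window, all `k`): a sandwich operator
`X ↦ ∑_{j<r} P_j X Q_j` with fewer than `n` terms that is scalar-valued on `M_n` vanishes identically
(on a rank-one `X` its value has rank `≤ r < n`, so the scalar is `0`; rank-one matrices span). -/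
theorem sandwich_scalar_eq_zero {n r : ℕ} (hr : r < n) (P Q : Fin r → Matrix (Fin n) (Fin n) ℂ)
    (h : ∀ X : Matrix (Fin n) (Fin n) ℂ, ∃ s : ℂ,
      (∑ j, P j * X * Q j) = s • (1 : Matrix (Fin n) (Fin n) ℂ)) :
    ∀ X : Matrix (Fin n) (Fin n) ℂ, (∑ j, P j * X * Q j) = 0 := by
  sorry

/-- EIGEN-SANDWICH: `D·[X,a]·E = 0` for all `X` with `D, E ≠ 0` forces `a` to act by one scalar on the
column space of `E` (from the left) and on the row space of `D` (from the right):
`D ⊗ aE = Da ⊗ E` in `M_n ⊗ M_n`. -/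
theorem eigen_of_sandwich {n : ℕ} (a D E : Matrix (Fin n) (Fin n) ℂ)
    (h : ∀ X : Matrix (Fin n) (Fin n) ℂ, D * (X * a - a * X) * E = 0) (hD : D ≠ 0) (hE : E ≠ 0) :
    ∃ s : ℂ, a * E = s • E ∧ D * a = s • D := by
  sorry

/-- NO `UT₃`-TYPE MASQUERADES (the natural rigid strengthening for the live branch `k = 3`, since
`var(UT₃) ⊂ var(M₃)`): if words of length `≤ d` (`d ≥ 5`) in `A` span `M_n`, `n ≥ 2`, then the
three-commutator law `[P₀,P₁][P₂,P₃][P₄,P₅] = 0` cannot hold for all `Pᵢ ∈ W_{eᵢ}` with `∑ eᵢ ≤ 2d`.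
(Assignment `P₂ = X ∈ W_d = M_n`, `P₃ = A 0`, the rest in `W_L`, `4L ≤ d - 1`; `eigen_of_sandwich` with
`D = E = [P,Q] ≠ 0` gives a common eigenvector of `A 0, A 1`, contradicting generation; so `W_L` is
commutative and `[A 0, A 1] = 0`, contradicting `false_of_commute`.) -/
theorem no_UT3_masquerade {n d : ℕ} {A : Fin 2 → Matrix (Fin n) (Fin n) ℂ} (hn : 2 ≤ n) (hd : 5 ≤ d)
    (hspan : Gen d A)
    (hUT : ∀ (e : Fin 6 → ℕ) (P : Fin 6 → Matrix (Fin n) (Fin n) ℂ), (∑ i, e i) ≤ 2 * d →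
      (∀ i, P i ∈ Submodule.span ℂ {M : Matrix (Fin n) (Fin n) ℂ |
        ∃ w : List (Fin 2), w.length ≤ e i ∧ (w.map A).prod = M}) →
      (P 0 * P 1 - P 1 * P 0) * (P 2 * P 3 - P 3 * P 2) * (P 4 * P 5 - P 5 * P 4) = 0) :
    False := by
  sorry

/-- WORD COUNT: generation in degree `d` forces `n² ≤ 2^(d+1) - 1` (so `d → ∞` with `n`). -/
theorem sq_le_of_gen {n d : ℕ} {A : Fin 2 → Matrix (Fin n) (Fin n) ℂ} (hspan : Gen d A) :
    n ^ 2 ≤ 2 ^ (d + 1) - 1 := by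
  sorry

open Summit.MatrixMultiplication.MatrixMultiplication.Theses.MatrixPointInterpolation
  (LongMasquerade WindowedKaplansky)

/-- THE DESCENT SCHEME: descent steps at every point size `k ≥ 2` refute `LongMasquerade`, i.e. prove
the route's kill target `WindowedKaplansky` (bottom of the ladder: `Win 1 (d + 2)` contains `xy - yx`,
so the generators commute, contradicting `LongMasqueradeNeg.false_of_commute`). -/
theorem windowedKaplansky_of_descent (hstep : ∀ k : ℕ, 2 ≤ k → DescentStep k) : WindowedKaplansky := by
  sorry

/-- What a descent step must overcome (recorded, not claimed): the level-one consequences of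
`Win k (d+E)` are (i) `Win k` itself on short words and (ii) VANISHING of every multilinear central
polynomial of `M_k` with one slot in `M_n` and the others in `W_L` (`sandwich_scalar_eq_zero`); the
T-ideal generated by `T(M_k)` and the central polynomials of `M_k` is contained in `T(M_{k-1})` but the
quotient is a NILPOTENT radical (Braun–Kemer–Razmyslov), so (i)+(ii) give products of `M_{k-1}`-identities,
not `Win (k-1)`; each further full slot costs the whole budget `d`.  This is the precise open point. -/
theorem descentStep_three_open : DescentStep 3 := by
  sorry

end Summit.MatrixMultiplication.MatrixMultiplication.Cruxes.LongMasquerade.WindowedDescent
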